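import Literature.AlgebraicGeometry.HodgeTheory.SemiregularityMapReal
import Literature.AlgebraicGeometry.Modules.SheafHomLeft
import Summits.HodgeConjecture.HodgeConjecture.Theorems.PadicSemiregularLiftPadicPridhamSemiregularitySemiregularOfIso
import HarnessLib

/-!
# Venture HSemireg — naturality of the twisted Atiyah classes `at_j`, `At^q` and isomorphism-invariance of
# Buchweitz–Flenner `I`-semiregularity (all form degrees)

HONEST FRAMING. Pure module-level algebra on the tree's REAL carriers; nothing about any explicit variety, and nothing
here says HC, HC_CM or HC_AV is proved. This file generalises the tree's landed `{0,1}` transport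
(`…PadicPridhamSemiregularity.isZeroOneSemiregular_of_iso`: `(σ_0, σ_1)`-semiregularity passes along an isomorphism
of finite locally free modules) to EVERY component `σ_q` of `HodgeTheory/SemiregularityHigherSigma.lean`, hence to
`IsHigherSemiregular hE q` and `IsISemiregular hE I` for every set `I` of form degrees — the predicate bound by the
venture's sheaf doors (`HasHyperbolicBFSheafSeed`, the named fact `BuchweitzFlenner2003_variationalHodge_ISemiregular`,
…). SCOPE: a transport along isomorphisms of MODULES on a FIXED scheme `X/S`; it says nothing about transporting `σ`
along an isomorphism of schemes `X ≅ X'`, and it is not a statement about perfect complexes.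

CONTENT (for `g : E₁ → E₂`, `e : E ≅ E'`, all modules on `X.left`, `X : Over (Spec S)`):
* `twistMap_app_wedgeD` — the twisting term `D(a, φ) = da ∧ φ` is natural:
  `(g ⊗ 1)(D_{E₁}(a, φ)) = D_{E₂}(a, (g ⊗ 1) φ)`;
* `twistJetMap g j : Pʲ(E₁) → Pʲ(E₂)`, `(φ, ψ) ↦ ((g ⊗ 1) φ, (g ⊗ 1) ψ)` — functoriality of the `Ωʲ`-twisted
  jet module (`𝒪`-linear for the twisted structures by the previous item), the morphism of twisted Atiyah sequences
  `twistJetShortComplexMap g j`, and the packaging as ADDITIVE FUNCTORS `twistFunctor Y G : F ↦ F ⊗ G` (any scheme `Y`,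
  any `G`; `twistHodgeFunctor X j` = the case `G = Ωʲ`),
  `twistJetFunctor X j : E ↦ Pʲ(E)` with the natural transformations `twistJetιNatTrans`, `twistJetπNatTrans`
  (objectwise the short exact twisted Atiyah sequence), and, for a homological complex `K` of modules of any shape,
  the termwise twisted Atiyah sequence of complexes `twistJetComplexShortComplex X j K` with its short exactness
  `twistJetComplexShortComplex_shortExact` (degreewise check);
* `atiyahClassStep_naturality` — `at_j(E₁) ≫ (g ⊗ 1_{Ωʲ⁺¹}) = (g ⊗ 1_{Ωʲ}) ≫ at_j(E₂)` in `Ext¹` (Mathlib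
  `ShortExact.extClass_naturality`), and `atiyahClassPower_naturality` — `At(E₁)^q ≫ (g ⊗ 1_{Ω^q}) =
  (g ⊗ 1_{Ω⁰}) ≫ At(E₂)^q` in `Ext^q` (induction on `q`); `toTwistHodgeZero_naturality` — `ι_{E₁} ≫ (g ⊗ 1) = g ≫ ι_{E₂}`;
* `sigmaHigher_conj` — **`σ_q^{E}(e ≫ x' ≫ e⁻¹) = σ_q^{E'}(x')`** for every `q`, from the items above and the landed
  conjugation invariance of the trace with coefficients (`traceExtCoeff_conj`);
* `isISemiregular_of_iso`, `isISemiregular_iff_of_iso`, `isHigherSemiregular_of_iso` — **`I`-semiregularity (any `I`)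
  and `q`-semiregularity are invariant under isomorphism of finite locally free modules**; `isZeroOneSemiregular_of_iso'`
  recovers the landed `{0,1}` case through `isISemiregular_zero_one_iff`.

## References

* R.-O. Buchweitz, H. Flenner, *A semiregularity map for modules and applications to deformations*, Compositio Math.
  137 (2003), §3 (Atiyah class), §4 (the algebra `A`, `At^k`, trace maps), §5 (`I`-semiregular). [BuchweitzFlenner2003]
* M. F. Atiyah, *Complex analytic connections in fibre bundles*, Trans. AMS 85 (1957), §4 Prop. 6–7 (functoriality
  of `D`, naturality of `b(E)`). [Atiyah1957]
* R. Hartshorne, *Algebraic Geometry*, GTM 52 (1977), II Ex. 5.1 (a), (b). [Hartshorne1977]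
-/

noncomputable section

open CategoryTheory CategoryTheory.Limits CategoryTheory.Abelian AlgebraicGeometry Opposite TopologicalSpace

namespace Summit.Ventures.HSemireg

open Literature.AlgebraicGeometry.Modules Literature.AlgebraicGeometry.Motives
open Literature.AlgebraicGeometry.HodgeTheory
open Summit.HodgeConjecture.HodgeConjecture.Theorems.PadicPridhamSemiregularity

universe w u

variable {S : Type u} [CommRing S] {X : Over (Spec (CommRingCat.of S))} {E₁ E₂ : X.left.Modules}

/-! ### Functoriality of the twisted jet module and naturality of the Atiyah steps -/

section TwistJet

variable {U : X.left.Opens}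

/-- **The twisting term is natural** (composition form): `g^∨|_U ≫ D_{E₁}(a, φ) = D_{E₂}(a, g^∨|_U ≫ φ)` (`g ⊗ 1` is
pre-composition with the transpose `g^∨`, `D(a, –)` a post-composition). [folklore] -/
lemma precomp_comp_wedgeD (g : E₁ ⟶ E₂) (j : ℕ) (a : Γ(X.left, U))
    (φ : (dual E₁).over U ⟶ (hodgeSheaf X j).over U) :
    (SheafOfModules.overFunctor _ U).map (sheafHomPrecomp g (unitModule X.left)) ≫ wedgeD E₁ j U a φ =
      wedgeD E₂ j U a ((SheafOfModules.overFunctor _ U).map (sheafHomPrecomp g (unitModule X.left)) ≫ φ) := by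
  unfold wedgeD
  rw [Category.assoc]

/-- **The twisting term is natural**: `(g ⊗ 1)(da ∧ φ) = da ∧ ((g ⊗ 1) φ)`. [folklore] -/
lemma twistMap_app_wedgeD (g : E₁ ⟶ E₂) (j : ℕ) (a : Γ(X.left, U))
    (φ : (dual E₁).over U ⟶ (hodgeSheaf X j).over U) :
    (twistMap g (hodgeSheaf X (j + 1))).app U (wedgeD E₁ j U a φ) =
      wedgeD E₂ j U a ((twistMap g (hodgeSheaf X j)).app U φ) := by
  rw [sheafHomPrecomp_app_apply, sheafHomPrecomp_app_apply, precomp_comp_wedgeD]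

/-- **Functoriality of the `Ωʲ`-twisted jet module** `Pʲ(E₁) → Pʲ(E₂)` along `g : E₁ → E₂`:
`(φ, ψ) ↦ ((g ⊗ 1) φ, (g ⊗ 1) ψ)`; `𝒪_X`-linear for the twisted structures `a • (φ, ψ) = (a φ, a ψ + da ∧ φ)`
because `(g ⊗ 1)(da ∧ φ) = da ∧ (g ⊗ 1) φ` (Atiyah 1957, Prop. 6, for `j = 0`). [cite: Atiyah1957, §4 Prop. 6] -/
def twistJetMap (g : E₁ ⟶ E₂) (j : ℕ) : twistJetModule E₁ j ⟶ twistJetModule E₂ j where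
  val := PresheafOfModules.homMk
    { app := fun U => AddCommGrpCat.ofHom
        { toFun := fun p : TwistJetSections E₁ j U.unop =>
            (TwistJetSections.mk ((twistMap g (hodgeSheaf X j)).app U.unop p.fst)
              ((twistMap g (hodgeSheaf X (j + 1))).app U.unop p.snd) : TwistJetSections E₂ j U.unop)
          map_zero' := TwistJetSections.ext ((twistMap g (hodgeSheaf X j)).app U.unop).hom.map_zero
            ((twistMap g (hodgeSheaf X (j + 1))).app U.unop).hom.map_zero
          map_add' := fun p q =>
            TwistJetSections.ext (((twistMap g (hodgeSheaf X j)).app U.unop).hom.map_add p.fst q.fst)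
              (((twistMap g (hodgeSheaf X (j + 1))).app U.unop).hom.map_add p.snd q.snd) }
      naturality := fun {U V} i => AddCommGrpCat.ext fun (p : TwistJetSections E₁ j U.unop) =>
        TwistJetSections.ext (Scheme.Modules.Hom.app_map_apply (twistMap g (hodgeSheaf X j)) i.unop p.fst)
          (Scheme.Modules.Hom.app_map_apply (twistMap g (hodgeSheaf X (j + 1))) i.unop p.snd) }
    (fun U (a : Γ(X.left, U.unop)) (p : TwistJetSections E₁ j U.unop) =>
      TwistJetSections.ext (by
        change (SheafOfModules.overFunctor _ U.unop).map (sheafHomPrecomp g (unitModule X.left)) ≫ (a • p.fst) =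
          a • ((SheafOfModules.overFunctor _ U.unop).map (sheafHomPrecomp g (unitModule X.left)) ≫ p.fst)
        rw [smul_overHom_def, smul_overHom_def, Category.assoc]) (by
        change (SheafOfModules.overFunctor _ U.unop).map (sheafHomPrecomp g (unitModule X.left)) ≫
            (a • p.snd + wedgeD E₁ j U.unop a p.fst) =
          a • ((SheafOfModules.overFunctor _ U.unop).map (sheafHomPrecomp g (unitModule X.left)) ≫ p.snd) +
            wedgeD E₂ j U.unop a
              ((SheafOfModules.overFunctor _ U.unop).map (sheafHomPrecomp g (unitModule X.left)) ≫ p.fst)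
        rw [Preadditive.comp_add, smul_overHom_def, smul_overHom_def, Category.assoc, precomp_comp_wedgeD]))

/-- Sections of `twistJetMap g j`: componentwise `g ⊗ 1`. [folklore] -/
@[simp]
lemma twistJetMap_app_apply (g : E₁ ⟶ E₂) (j : ℕ) (U : X.left.Opens) (p : TwistJetSections E₁ j U) :
    (twistJetMap g j).app U p =
      (TwistJetSections.mk ((twistMap g (hodgeSheaf X j)).app U p.fst)
        ((twistMap g (hodgeSheaf X (j + 1))).app U p.snd) : TwistJetSections E₂ j U) := rfl

/-- **The morphism of twisted Atiyah sequences** `(g ⊗ 1_{Ωʲ⁺¹}, Pʲ(g), g ⊗ 1_{Ωʲ})` from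
`0 → E₁ ⊗ Ωʲ⁺¹ → Pʲ(E₁) → E₁ ⊗ Ωʲ → 0` to the same sequence for `E₂`. [folklore] -/
def twistJetShortComplexMap (g : E₁ ⟶ E₂) (j : ℕ) :
    twistJetShortComplex E₁ j ⟶ twistJetShortComplex E₂ j where
  τ₁ := twistMap g (hodgeSheaf X (j + 1))
  τ₂ := twistJetMap g j
  τ₃ := twistMap g (hodgeSheaf X j)
  comm₁₂ := Scheme.Modules.hom_ext _ _ fun U => AddCommGrpCat.ext
    fun (_ : (dual E₁).over U ⟶ (hodgeSheaf X (j + 1)).over U) =>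
      TwistJetSections.ext (((twistMap g (hodgeSheaf X j)).app U).hom.map_zero).symm rfl
  comm₂₃ := Scheme.Modules.hom_ext _ _ fun U => AddCommGrpCat.ext fun (_ : TwistJetSections E₁ j U) => rfl

variable [HasExt.{w} X.left.Modules]

/-- **Naturality of the Atiyah steps**: for `g : E₁ → E₂` and every `j`,
`at_j(E₁) ≫ (g ⊗ 1_{Ωʲ⁺¹}) = (g ⊗ 1_{Ωʲ}) ≫ at_j(E₂)` in `Ext¹(E₁ ⊗ Ωʲ, E₂ ⊗ Ωʲ⁺¹)` — `ShortExact.extClass` is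
natural (Mathlib) along the morphism of twisted Atiyah sequences `twistJetShortComplexMap g j`.
[cite: Atiyah1957, §4 Prop. 7] [cite: BuchweitzFlenner2003, §3] -/
theorem atiyahClassStep_naturality (g : E₁ ⟶ E₂) (j : ℕ) :
    (atiyahClassStep E₁ j).comp (Ext.mk₀ (twistMap g (hodgeSheaf X (j + 1)))) (add_zero 1) =
      (Ext.mk₀ (twistMap g (hodgeSheaf X j))).comp (atiyahClassStep E₂ j) (zero_add 1) :=
  (twistJetShortComplex_shortExact E₁ j).extClass_naturality (twistJetShortComplex_shortExact E₂ j)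
    (twistJetShortComplexMap g j)

end TwistJet

/-! ### Functoriality: `– ⊗ Ωʲ` and `Pʲ` as additive functors, `ι` and `π` as natural transformations -/

section ModulesOnly

variable {Y : Scheme.{u}} {F₁ F₂ F₃ : Y.Modules}

/-- The first-variable functoriality `sheafHomPrecomp` (file `…PadicPridhamSemiregularityTraceConjugation`) IS the
Literature's `Modules.sheafHomMapLeft` (same sections `ψ ↦ g|_U ≫ ψ`); any scheme. [folklore] -/
lemma sheafHomPrecomp_eq_sheafHomMapLeft (g : F₁ ⟶ F₂) (M : Y.Modules) :
    sheafHomPrecomp g M = sheafHomMapLeft g M := rfl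

/-- `𝟙_F ⊗ 1_G = 𝟙` (any scheme). [folklore] -/
@[simp]
lemma twistMap_id (F G : Y.Modules) : twistMap (𝟙 F) G = 𝟙 (sheafHom (dual F) G) := by
  dsimp only [twistMap]
  rw [sheafHomPrecomp_id, sheafHomPrecomp_id]

/-- `(f ≫ g) ⊗ 1_G = (f ⊗ 1_G) ≫ (g ⊗ 1_G)` (the double transpose is covariant; any scheme). [folklore] -/
lemma twistMap_comp (f : F₁ ⟶ F₂) (g : F₂ ⟶ F₃) (G : Y.Modules) :
    twistMap (f ≫ g) G = twistMap f G ≫ twistMap g G := by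
  dsimp only [twistMap]
  rw [sheafHomPrecomp_comp, sheafHomPrecomp_comp]

/-- `(f + g) ⊗ 1_G = f ⊗ 1_G + g ⊗ 1_G` (any scheme). [folklore] -/
lemma twistMap_add (f g : F₁ ⟶ F₂) (G : Y.Modules) :
    twistMap (f + g) G = twistMap f G + twistMap g G := by
  simp only [twistMap, sheafHomPrecomp_eq_sheafHomMapLeft, sheafHomMapLeft_add]

/-- `0 ⊗ 1_G = 0` (any scheme). [folklore] -/
@[simp]
lemma twistMap_zero (G : Y.Modules) : twistMap (0 : F₁ ⟶ F₂) G = 0 := by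
  simp only [twistMap, sheafHomPrecomp_eq_sheafHomMapLeft, sheafHomMapLeft_zero]

variable (Y) in
/-- **The twist functor `F ↦ F ⊗ G`** on the models `𝓗om(F^∨, G)` (on maps `g ↦ g ⊗ 1 = 𝓗om(g^∨, G)`), for any
`𝒪_Y`-module `G` on any scheme `Y`. [cite: Hartshorne1977, II Ex. 5.1 (b)] -/
@[simps]
def twistFunctor (G : Y.Modules) : Y.Modules ⥤ Y.Modules where
  obj F := sheafHom (dual F) G
  map g := twistMap g G
  map_id F := twistMap_id F G
  map_comp f g := twistMap_comp f g G

/-- `F ↦ F ⊗ G` is additive. [folklore] -/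
instance twistFunctor_additive (G : Y.Modules) : (twistFunctor Y G).Additive where
  map_add := twistMap_add _ _ _

end ModulesOnly

section Functoriality

variable {E₃ : X.left.Modules}

variable (X) in
/-- **The twist functor `E ↦ E ⊗ Ωʲ_{X/S}`** = `twistFunctor X.left Ωʲ` (models `𝓗om(E^∨, Ωʲ)`, i.e. `twistHodge E j`
on objects and `twistMap g Ωʲ` on maps). [cite: Hartshorne1977, II Ex. 5.1 (b)] -/
abbrev twistHodgeFunctor (j : ℕ) : X.left.Modules ⥤ X.left.Modules := twistFunctor X.left (hodgeSheaf X j)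

/-- `Pʲ(𝟙_E) = 𝟙`. [folklore] -/
@[simp]
lemma twistJetMap_id (E : X.left.Modules) (j : ℕ) : twistJetMap (𝟙 E) j = 𝟙 (twistJetModule E j) := by
  refine Scheme.Modules.hom_ext _ _ fun U => AddCommGrpCat.ext fun (p : TwistJetSections E j U) => ?_
  change (twistJetMap (𝟙 E) j).app U p = p
  rw [twistJetMap_app_apply, twistMap_id, twistMap_id]
  rfl

/-- `Pʲ(f ≫ g) = Pʲ(f) ≫ Pʲ(g)`. [folklore] -/
lemma twistJetMap_comp (f : E₁ ⟶ E₂) (g : E₂ ⟶ E₃) (j : ℕ) :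
    twistJetMap (f ≫ g) j = twistJetMap f j ≫ twistJetMap g j := by
  refine Scheme.Modules.hom_ext _ _ fun U => AddCommGrpCat.ext fun (p : TwistJetSections E₁ j U) => ?_
  change (twistJetMap (f ≫ g) j).app U p = (twistJetMap g j).app U ((twistJetMap f j).app U p)
  rw [twistJetMap_app_apply, twistJetMap_app_apply, twistJetMap_app_apply, twistMap_comp, twistMap_comp]
  rfl

/-- `Pʲ(f + g) = Pʲ(f) + Pʲ(g)`. [folklore] -/
lemma twistJetMap_add (f g : E₁ ⟶ E₂) (j : ℕ) :
    twistJetMap (f + g) j = twistJetMap f j + twistJetMap g j := by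
  refine Scheme.Modules.hom_ext _ _ fun U => AddCommGrpCat.ext fun (p : TwistJetSections E₁ j U) => ?_
  change (twistJetMap (f + g) j).app U p = (twistJetMap f j).app U p + (twistJetMap g j).app U p
  rw [twistJetMap_app_apply, twistJetMap_app_apply, twistJetMap_app_apply, twistMap_add, twistMap_add,
    Scheme.Modules.Hom.add_app, Scheme.Modules.Hom.add_app]
  rfl

variable (X) in
/-- **The twisted jet functor `E ↦ Pʲ(E)`** (maps `g ↦ Pʲ(g) = (g ⊗ 1, g ⊗ 1)`). [cite: Atiyah1957, §4 Prop. 6] -/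
@[simps]
def twistJetFunctor (j : ℕ) : X.left.Modules ⥤ X.left.Modules where
  obj E := twistJetModule E j
  map g := twistJetMap g j
  map_id E := twistJetMap_id E j
  map_comp f g := twistJetMap_comp f g j

/-- `E ↦ Pʲ(E)` is additive. [folklore] -/
instance twistJetFunctor_additive (j : ℕ) : (twistJetFunctor X j).Additive where
  map_add := twistJetMap_add _ _ _

variable (X) in
/-- The inclusions `E ⊗ Ωʲ⁺¹ → Pʲ(E)` form a natural transformation `(– ⊗ Ωʲ⁺¹) ⟶ Pʲ`. [folklore] -/
@[simps]
def twistJetιNatTrans (j : ℕ) : twistHodgeFunctor X (j + 1) ⟶ twistJetFunctor X j where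
  app E := twistJetι E j
  naturality _ _ g := (twistJetShortComplexMap g j).comm₁₂

variable (X) in
/-- The projections `Pʲ(E) → E ⊗ Ωʲ` form a natural transformation `Pʲ ⟶ (– ⊗ Ωʲ)`. [folklore] -/
@[simps]
def twistJetπNatTrans (j : ℕ) : twistJetFunctor X j ⟶ twistHodgeFunctor X j where
  app E := twistJetπ E j
  naturality _ _ g := (twistJetShortComplexMap g j).comm₂₃

end Functoriality

section Complexes

variable {ι : Type*} {c : ComplexShape ι}

variable (X) in
/-- For a homological complex `K` of `𝒪_X`-modules (any shape `c`): the TERMWISE `Ωʲ`-twisted Atiyah sequence of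
complexes `K ⊗ Ωʲ⁺¹ → Pʲ(K) → K ⊗ Ωʲ` (the functors `twistHodgeFunctor`, `twistJetFunctor` and the natural
transformations `ι`, `π` applied termwise, `Functor/NatTrans.mapHomologicalComplex`). [folklore] -/
def twistJetComplexShortComplex (j : ℕ) (K : HomologicalComplex X.left.Modules c) :
    ShortComplex (HomologicalComplex X.left.Modules c) :=
  ShortComplex.mk ((NatTrans.mapHomologicalComplex (twistJetιNatTrans X j) c).app K)
    ((NatTrans.mapHomologicalComplex (twistJetπNatTrans X j) c).app K) (by
      refine HomologicalComplex.hom_ext _ _ fun i => ?_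
      simp only [HomologicalComplex.comp_f, HomologicalComplex.zero_f, NatTrans.mapHomologicalComplex_app_f,
        twistJetιNatTrans_app, twistJetπNatTrans_app]
      exact twistJetι_comp_twistJetπ (K.X i) j)

/-- **The termwise twisted Atiyah sequence of a complex is short exact** (`0 → K ⊗ Ωʲ⁺¹ → Pʲ(K) → K ⊗ Ωʲ → 0` in the
abelian category of complexes): short exactness of complexes is checked degreewise (Mathlib
`HomologicalComplex.shortExact_of_degreewise_shortExact`), where it is `twistJetShortComplex_shortExact`. (Its
connecting morphism in the derived category — not constructed in this file — is the natural candidate for the `j`-th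
Atiyah step of the complex `K`.) [folklore] -/
theorem twistJetComplexShortComplex_shortExact (j : ℕ) (K : HomologicalComplex X.left.Modules c) :
    (twistJetComplexShortComplex X j K).ShortExact :=
  HomologicalComplex.shortExact_of_degreewise_shortExact _ fun i =>
    twistJetShortComplex_shortExact (K.X i) j

end Complexes

section Power

/-- **Naturality of `ι_E : E → E ⊗ Ω⁰`** (biduality followed by `𝒪_X ≅ Ω⁰`): `ι_{E₁} ≫ (g ⊗ 1_{Ω⁰}) = g ≫ ι_{E₂}`
— on sections, `g^∨ ≫ ev_s = ev_{g s}`. [cite: Hartshorne1977, II Ex. 5.1 (a)] -/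
theorem toTwistHodgeZero_naturality (g : E₁ ⟶ E₂) :
    toTwistHodgeZero E₁ ≫ twistMap g (hodgeSheaf X 0) = g ≫ toTwistHodgeZero E₂ := by
  unfold toTwistHodgeZero
  rw [Category.assoc, ← sheafHomPrecomp_comp_sheafHomMap, ← Category.assoc, ← Category.assoc]
  congr 1
  refine Scheme.Modules.hom_ext _ _ fun U => AddCommGrpCat.ext fun (s : Γ(E₁, U)) => ?_
  change (sheafHomPrecomp (sheafHomPrecomp g (unitModule X.left)) (unitModule X.left)).app U
      ((toBidual E₁ (unitModule X.left)).app U s) = (toBidual E₂ (unitModule X.left)).app U (g.app U s)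
  rw [toBidual_app_apply, toBidual_app_apply, sheafHomPrecomp_app_apply, over_map_precomp_comp_evalAt]

variable [HasExt.{w} X.left.Modules]

/-- **Naturality of the Yoneda powers of the Atiyah class**: for `g : E₁ → E₂` and every `q`,
`At(E₁)^q ≫ (g ⊗ 1_{Ω^q}) = (g ⊗ 1_{Ω⁰}) ≫ At(E₂)^q` in `Ext^q(E₁ ⊗ Ω⁰, E₂ ⊗ Ω^q)` (induction on `q` from
`atiyahClassStep_naturality` and associativity of the Yoneda composition; `At^k` as in BF §4).
[cite: BuchweitzFlenner2003, §4 (the algebra A, At^k)] -/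
theorem atiyahClassPower_naturality (g : E₁ ⟶ E₂) (q : ℕ) :
    (atiyahClassPower E₁ q).comp (Ext.mk₀ (twistMap g (hodgeSheaf X q))) (add_zero q) =
      (Ext.mk₀ (twistMap g (hodgeSheaf X 0))).comp (atiyahClassPower E₂ q) (zero_add q) := by
  induction q with
  | zero =>
    rw [atiyahClassPower_zero, atiyahClassPower_zero, Ext.mk₀_comp_mk₀, Ext.mk₀_comp_mk₀, Category.id_comp,
      Category.comp_id]
  | succ q ih =>
    rw [atiyahClassPower_succ, atiyahClassPower_succ,
      Ext.comp_assoc_of_third_deg_zero (atiyahClassPower E₁ q) (atiyahClassStep E₁ q)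
        (Ext.mk₀ (twistMap g (hodgeSheaf X (q + 1)))),
      atiyahClassStep_naturality,
      ← Ext.comp_assoc_of_second_deg_zero (atiyahClassPower E₁ q) (Ext.mk₀ (twistMap g (hodgeSheaf X q)))
        (atiyahClassStep E₂ q), ih]
    exact Ext.comp_assoc _ _ _ (zero_add q) rfl (by omega)

end Power

/-! ### Conjugation invariance of every `σ_q` and transport of `I`-semiregularity -/

section Sigma

variable [HasExt.{w} X.left.Modules] {E E' : X.left.Modules} (e : E ≅ E') (hE : IsFiniteLocallyFree E)
  (hE' : IsFiniteLocallyFree E')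

include e

/-- **`σ_q` is conjugation-invariant** for every form degree `q`: `σ_q^{E}(e ≫ x' ≫ e⁻¹) = σ_q^{E'}(x')` for
`e : E ≅ E'` — naturality of `ι` and of `At^q` along `e⁻¹`, then the landed conjugation invariance of the trace with
coefficients `Ω^q` (`traceExtCoeff_conj`). [cite: BuchweitzFlenner2003, Def. 4.1 and §4 (trace maps)] -/
theorem sigmaHigher_conj (q : ℕ) (x' : Ext.{w} E' E' 2) :
    sigmaHigher hE q ((Ext.mk₀ e.hom).comp (x'.comp (Ext.mk₀ e.inv) (add_zero 2)) (zero_add 2)) =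
      sigmaHigher hE' q x' := by
  have hR : ((x'.comp (Ext.mk₀ (toTwistHodgeZero E')) (add_zero 2)).comp (atiyahClassPower E' q)
      (add_comm 2 q)).comp (Ext.mk₀ (twistMap e.inv (hodgeSheaf X q))) (add_zero (q + 2)) =
        (x'.comp (Ext.mk₀ (e.inv ≫ toTwistHodgeZero E)) (add_zero 2)).comp (atiyahClassPower E q)
          (add_comm 2 q) := by
    rw [Ext.comp_assoc_of_third_deg_zero (x'.comp (Ext.mk₀ (toTwistHodgeZero E')) (add_zero 2))
        (atiyahClassPower E' q) (Ext.mk₀ (twistMap e.inv (hodgeSheaf X q))),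
      atiyahClassPower_naturality e.inv q,
      ← Ext.comp_assoc_of_second_deg_zero (x'.comp (Ext.mk₀ (toTwistHodgeZero E')) (add_zero 2))
        (Ext.mk₀ (twistMap e.inv (hodgeSheaf X 0))) (atiyahClassPower E q),
      Ext.comp_assoc_of_third_deg_zero x' (Ext.mk₀ (toTwistHodgeZero E'))
        (Ext.mk₀ (twistMap e.inv (hodgeSheaf X 0))),
      Ext.mk₀_comp_mk₀, toTwistHodgeZero_naturality e.inv]
  have hL : ((Ext.mk₀ e.hom).comp (x'.comp (Ext.mk₀ e.inv) (add_zero 2)) (zero_add 2)).comp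
      (Ext.mk₀ (toTwistHodgeZero E)) (add_zero 2) =
        (Ext.mk₀ e.hom).comp (x'.comp (Ext.mk₀ (e.inv ≫ toTwistHodgeZero E)) (add_zero 2)) (zero_add 2) := by
    rw [Ext.comp_assoc_of_third_deg_zero, Ext.comp_assoc_of_third_deg_zero, Ext.mk₀_comp_mk₀]
  rw [sigmaHigher_apply, sigmaHigher_apply, traceCoeffToCohomology, traceCoeffToCohomology,
    AddMonoidHom.comp_apply, AddMonoidHom.comp_apply, ← traceExtCoeff_conj e hE hE', hR, hL]
  congr 2
  exact Ext.comp_assoc _ _ _ (zero_add 2) (add_comm 2 q) (by omega)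

/-- **`I`-semiregularity is invariant under isomorphism** of finite locally free modules, for EVERY set `I` of form
degrees: conjugation `x' ↦ e ≫ x' ≫ e⁻¹ : Ext²(E', E') → Ext²(E, E)` is injective (inverse: conjugation by `e⁻¹`)
and intertwines every `σ_q` (`sigmaHigher_conj`). [cite: BuchweitzFlenner2003, §5 (I-semiregular)] -/
theorem isISemiregular_of_iso {I : Set ℕ} (h : IsISemiregular hE I) : IsISemiregular hE' I := by
  intro x' hx'
  have hc : (Ext.mk₀ e.hom).comp (x'.comp (Ext.mk₀ e.inv) (add_zero 2)) (zero_add 2) = 0 :=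
    h _ fun q hq => by rw [sigmaHigher_conj e hE hE', hx' q hq]
  have := congrArg (fun z : Ext E E 2 => (Ext.mk₀ e.inv).comp (z.comp (Ext.mk₀ e.hom) (add_zero 2))
    (zero_add 2)) hc
  simpa only [Ext.comp_assoc_of_second_deg_zero, Ext.comp_assoc_of_third_deg_zero, Ext.mk₀_comp_mk₀,
    Ext.mk₀_comp_mk₀_assoc, Iso.inv_hom_id, Ext.mk₀_id_comp, Ext.comp_mk₀_id, Ext.zero_comp,
    Ext.comp_zero] using this

/-- `I`-semiregularity of `E` and of `E' ≅ E` are equivalent. [cite: BuchweitzFlenner2003, §5 (I-semiregular)] -/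
theorem isISemiregular_iff_of_iso (I : Set ℕ) : IsISemiregular hE I ↔ IsISemiregular hE' I :=
  ⟨isISemiregular_of_iso e hE hE', isISemiregular_of_iso e.symm hE' hE⟩

/-- **`q`-semiregularity is invariant under isomorphism** of finite locally free modules (the case `I = {q}`).
[cite: BuchweitzFlenner2003, §1 (k-semiregular)] -/
theorem isHigherSemiregular_of_iso (q : ℕ) (h : IsHigherSemiregular hE q) : IsHigherSemiregular hE' q :=
  (isHigherSemiregular_iff_isISemiregular_singleton hE' q).2
    (isISemiregular_of_iso e hE hE' ((isHigherSemiregular_iff_isISemiregular_singleton hE q).1 h))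

/-- **Consistency with the landed `{0,1}` transport.** Specialising `isISemiregular_of_iso` to `I = {0, 1}` and
translating through `isISemiregular_zero_one_iff` (`SemiregularityMapReal.lean`) recovers
`…PadicPridhamSemiregularity.isZeroOneSemiregular_of_iso` (which is proved there directly on `σ_0`, `σ_1`).
[cite: BuchweitzFlenner2003, §5 (I-semiregular)] -/
theorem isZeroOneSemiregular_of_iso' (h : IsZeroOneSemiregular hE) : IsZeroOneSemiregular hE' :=
  (isISemiregular_zero_one_iff hE').1
    (isISemiregular_of_iso e hE hE' ((isISemiregular_zero_one_iff hE).2 h))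

end Sigma

end Summit.Ventures.HSemireg

end
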